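import Literature.MathematicalPhysics.QuantumFieldTheory.BalabanImbrieJaffe1984to88.BIJ88WalkGeometryZd

/-!
# `BalabanImbrieJaffe1984to88.BIJ88Assoc575Zd` — T. Bałaban, J. Imbrie, A. Jaffe, *Effective action and cluster
properties of the abelian Higgs model*, Commun. Math. Phys. **114** (1988) 257–315 [BalabanImbrieJaffe1988]:
Sect. 5.7 p. 289, the ASSOCIATION MAP of **(5.7.5)** realized on `ℤ^d` — *"To each b ∈ T_η and each collection of
bonds b₁, …, b_m ∈ T^{(k)} we associate in some arbitrary manner a set X (a connected union of r(e_k)-cubes containing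
them)"* — together with the cube geometry (containment, connectedness, tightness) that the one-line proof of **(5.7.6)** p. 290 uses.

statement-level skeleton of published theorems with citation tags; proofs where landed; nothing here is a claim about the Yang–Mills mass gap

PDF held: `paper:balaban1988-cmp114-bij-abelian-higgs-effective-action` (journal page = PDF page + 256).  Pages read as
images: PDF pp. 33–34 (journal 289–290), `g4png.py` ×2 renders (seat folder `renders/original-p033-x2.png`, `-p034-x2.png`).

CITATION HEADER (lean-in-tree rule).  Part of the lit-balaban TYPED SKELETON (HOME `run/shared/lean/pub/lit-balaban/`),
Phase 2, seat p36 (gen 3, unit `lit-balaban-p36`); file 1/2 for row **C2.Eq5.7.6** of `HOME/lit-balaban-r16/ROWS-C2-part2.md`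
(typed leaf `BIJ88Sect5StatementsPart2.Ineq576`, p240155; the localized powers `w_{b,m}(X)` of (5.7.5) are the CONCRETE
`BIJ88Sect5StatementsPart4.wbm` of r16, p245624, whose association map `assoc : (Fin m → β) → ξ` is abstract).  File 2/2
(`BIJ88Ineq576Proof`) proves (5.7.6) for `wbm` with THIS association.  WHAT IS REPRODUCED, and how (every item PROVED;
Mathlib-level lattice arithmetic on `ℤ^d`, cubes = cube indices `BIJ88WalkGeometryZd.cubeIdx ℓ` of side `ℓ ≈ r(e_k)`,
distances = the sup-norm `BIJ88WalkGeometryZd.supDist` — a model choice; print fixes no norm and an equivalent norm changes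
only constants):
* §1 the `ℓ¹`-STAIRCASE between two cube indices (`corner`, `seg`, `stair`): contains both ends, `card ≤ ‖i − j‖₁ + d`
  (`card_stair_le`), and is a chain of touching cubes.
* §2 **the association** `assocZd pos ℓ b m t = cube(b) ∪ ⋃_l stair(cube(b), cube(b_l))` — one admissible instance of the
  print's *"in some arbitrary manner"*: it CONTAINS the cubes of `b, b₁, …, b_m` (`cube_mem_assocZd`, `cube_tuple_mem_assocZd`),
  it is CONNECTED as a union of `r(e_k)`-cubes (`assocZd_connected`: the touching graph `B4RandomWalk213.cubeAdj id` induced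
  on it is connected — the notion of `BIJ88RandomWalk242.region_connected`), and it is TIGHT:
  `ℓ(|X| − 1) ≤ d·Σ_l dist(b,b_l) + 2d·m·ℓ` (`tight_assocZd`, from the cube arithmetic `ℓ|x/ℓ − y/ℓ| ≤ |x − y| + ℓ − 1`).
  READING NOTE (recorded, not adjudicated): (5.7.6) cannot hold for a literally arbitrary association (attaching a large
  `X` to nearby bonds leaves only the factor `e^{−c r(e_k) m}`); it holds for every tight one, in particular this one.
NOT here: the kernel `w₅`, the field `A′`, the lattice sum and the bound (5.7.6) itself (file 2/2).  No new `Prop` facts;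
definitions with bodies only (`l1`, `corner`, `seg`, `stair`, `assocZd`).
-/

namespace Literature.MathematicalPhysics.QuantumFieldTheory.BalabanImbrieJaffe1984to88.BIJ88Assoc575Zd

open Finset
open Literature.MathematicalPhysics.QuantumFieldTheory.Balaban1983to89.B4RandomWalk213 (cubeAdj)
open BIJ88WalkGeometryZd

noncomputable section

variable {dd : ℕ}

/-! ## §1 The `ℓ¹`-staircase between two cube indices -/

/-- the `ℓ¹` size `Σ_μ |i_μ − j_μ|` of a cube-index difference (number of unit steps of a staircase from `i` to `j`).
[cite: BalabanImbrieJaffe1988, (5.7.5) p.289] -/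
def l1 (i j : Fin dd → ℤ) : ℕ := ∑ μ, (i μ - j μ).natAbs

/-- the `μ`-th CORNER of the staircase from `i` to `j`: coordinates `< μ` already moved to `j`, the others still at `i`
(`corner 0 = i`, `corner d = j`). [cite: BalabanImbrieJaffe1988, (5.7.5) p.289] -/
def corner (i j : Fin dd → ℤ) (μ : ℕ) : Fin dd → ℤ := fun ν => if (ν : ℕ) < μ then j ν else i ν

/-- `corner 0 = i`. [cite: BalabanImbrieJaffe1988, (5.7.5) p.289] -/
theorem corner_zero (i j : Fin dd → ℤ) : corner i j 0 = i := by
  funext ν; simp [corner]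

/-- `corner d = j`. [cite: BalabanImbrieJaffe1988, (5.7.5) p.289] -/
theorem corner_dd (i j : Fin dd → ℤ) : corner i j dd = j := by
  funext ν; simp [corner, ν.isLt]

/-- the `μ`-th SEGMENT of the staircase: the corner `corner μ` with its `μ`-th coordinate running over the integer
interval between `i_μ` and `j_μ`. [cite: BalabanImbrieJaffe1988, (5.7.5) p.289] -/
def seg (i j : Fin dd → ℤ) (μ : Fin dd) : Finset (Fin dd → ℤ) :=
  (Finset.Icc (min (i μ) (j μ)) (max (i μ) (j μ))).image fun s => Function.update (corner i j μ) μ s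

/-- the STAIRCASE from `i` to `j` = the union of its `d` segments. [cite: BalabanImbrieJaffe1988, (5.7.5) p.289] -/
def stair (i j : Fin dd → ℤ) : Finset (Fin dd → ℤ) := Finset.univ.biUnion fun μ => seg i j μ

/-- membership in a segment. [cite: BalabanImbrieJaffe1988, (5.7.5) p.289] -/
theorem mem_seg {i j : Fin dd → ℤ} {μ : Fin dd} {p : Fin dd → ℤ} :
    p ∈ seg i j μ ↔ ∃ s, s ∈ Finset.Icc (min (i μ) (j μ)) (max (i μ) (j μ)) ∧ Function.update (corner i j μ) μ s = p := by
  unfold seg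
  rw [Finset.mem_image]

/-- the corner `corner μ` is the `s = i_μ` point of the `μ`-th segment. [cite: BalabanImbrieJaffe1988, (5.7.5) p.289] -/
theorem update_corner_self (i j : Fin dd → ℤ) (μ : Fin dd) :
    Function.update (corner i j μ) μ (i μ) = corner i j μ := by
  funext ν
  by_cases hν : ν = μ
  · subst hν; simp [corner]
  · rw [Function.update_of_ne hν]

/-- the next corner `corner (μ+1)` is the `s = j_μ` point of the `μ`-th segment. [cite: BalabanImbrieJaffe1988, (5.7.5) p.289] -/
theorem update_corner_next (i j : Fin dd → ℤ) (μ : Fin dd) :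
    Function.update (corner i j μ) μ (j μ) = corner i j (μ + 1) := by
  funext ν
  by_cases hν : ν = μ
  · subst hν; simp [corner]
  · rw [Function.update_of_ne hν]
    have hν' : (ν : ℕ) ≠ μ := fun h => hν (Fin.ext h)
    unfold corner
    split_ifs <;> omega

/-- `corner μ ∈ seg μ`. [cite: BalabanImbrieJaffe1988, (5.7.5) p.289] -/
theorem corner_mem_seg (i j : Fin dd → ℤ) (μ : Fin dd) : corner i j μ ∈ seg i j μ :=
  mem_seg.mpr ⟨i μ, by simp [Finset.mem_Icc], update_corner_self i j μ⟩

/-- `corner (μ+1) ∈ seg μ`. [cite: BalabanImbrieJaffe1988, (5.7.5) p.289] -/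
theorem corner_next_mem_seg (i j : Fin dd → ℤ) (μ : Fin dd) : corner i j (μ + 1) ∈ seg i j μ :=
  mem_seg.mpr ⟨j μ, by simp [Finset.mem_Icc], update_corner_next i j μ⟩

/-- the staircase contains its start `i` (for `d ≥ 1`). [cite: BalabanImbrieJaffe1988, (5.7.5) p.289] -/
theorem left_mem_stair (hd : 0 < dd) (i j : Fin dd → ℤ) : i ∈ stair i j := by
  unfold stair
  rw [Finset.mem_biUnion]
  refine ⟨⟨0, hd⟩, Finset.mem_univ _, ?_⟩
  have h := corner_mem_seg i j ⟨0, hd⟩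
  rwa [show ((⟨0, hd⟩ : Fin dd) : ℕ) = 0 from rfl, corner_zero] at h

/-- the staircase contains its end `j` (for `d ≥ 1`). [cite: BalabanImbrieJaffe1988, (5.7.5) p.289] -/
theorem right_mem_stair (hd : 0 < dd) (i j : Fin dd → ℤ) : j ∈ stair i j := by
  unfold stair
  rw [Finset.mem_biUnion]
  refine ⟨⟨dd - 1, by omega⟩, Finset.mem_univ _, ?_⟩
  have h := corner_next_mem_seg i j ⟨dd - 1, by omega⟩
  rwa [show ((⟨dd - 1, by omega⟩ : Fin dd) : ℕ) + 1 = dd by simp; omega, corner_dd] at h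

/-- a segment has at most `|i_μ − j_μ| + 1` cubes. [cite: BalabanImbrieJaffe1988, (5.7.5) p.289] -/
theorem card_seg_le (i j : Fin dd → ℤ) (μ : Fin dd) : (seg i j μ).card ≤ (i μ - j μ).natAbs + 1 := by
  unfold seg
  refine Finset.card_image_le.trans ?_
  rw [Int.card_Icc]
  omega

/-- **CARD OF THE STAIRCASE**: `|stair(i,j)| ≤ ‖i − j‖₁ + d`. [cite: BalabanImbrieJaffe1988, (5.7.5) p.289] -/
theorem card_stair_le (i j : Fin dd → ℤ) : (stair i j).card ≤ l1 i j + dd := by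
  unfold stair l1
  refine Finset.card_biUnion_le.trans ?_
  calc ∑ μ, (seg i j μ).card ≤ ∑ μ, ((i μ - j μ).natAbs + 1) := Finset.sum_le_sum fun μ _ => card_seg_le i j μ
    _ = (∑ μ, (i μ - j μ).natAbs) + dd := by
        rw [Finset.sum_add_distrib, Finset.sum_const, Finset.card_univ, Fintype.card_fin, smul_eq_mul, mul_one]

/-! ### The staircase is a chain of touching cubes -/

/-- two points of `ℤ^d` differing only in one coordinate, by at most one, TOUCH (`cubeAdj id`: every coordinate differs
by `≤ 1`). [cite: BalabanImbrieJaffe1988, (5.7.5) p.289] -/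
theorem touch_update (c : Fin dd → ℤ) (μ : Fin dd) {s s' : ℤ} (h : |s - s'| ≤ 1) :
    cubeAdj id (Function.update c μ s) (Function.update c μ s') := by
  intro ν
  by_cases hν : ν = μ
  · subst hν; simpa using h
  · simp [Function.update_of_ne hν]

/-- the touching graph induced on a cube set `X`: equal or touching cubes of `X` are joined (reflexive–adjacent step).
[cite: BalabanImbrieJaffe1988, (5.7.5) p.289] -/
theorem reachable_of_touch {X : Finset (Fin dd → ℤ)} {p q : Fin dd → ℤ} (hp : p ∈ (↑X : Set (Fin dd → ℤ)))
    (hq : q ∈ (↑X : Set (Fin dd → ℤ))) (h : p = q ∨ cubeAdj id p q) :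
    ((SimpleGraph.fromRel (cubeAdj (id : (Fin dd → ℤ) → Fin dd → ℤ))).induce (↑X : Set (Fin dd → ℤ))).Reachable
      ⟨p, hp⟩ ⟨q, hq⟩ := by
  by_cases hpq : p = q
  · subst hpq; rfl
  · refine SimpleGraph.Adj.reachable ?_
    rw [SimpleGraph.induce_adj, SimpleGraph.fromRel_adj]
    exact ⟨hpq, Or.inl (h.resolve_left hpq)⟩

/-- along the `μ`-th segment (inside any cube set `X` containing it) every point is reachable from the corner `corner μ`
— induction on the distance `|s − i_μ|` along the segment. [cite: BalabanImbrieJaffe1988, (5.7.5) p.289] -/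
theorem reachable_seg (i j : Fin dd → ℤ) (μ : Fin dd) (X : Finset (Fin dd → ℤ)) (hX : seg i j μ ⊆ X)
    (h0 : corner i j μ ∈ (↑X : Set (Fin dd → ℤ))) :
    ∀ (n : ℕ) (s : ℤ), (s - i μ).natAbs = n → s ∈ Finset.Icc (min (i μ) (j μ)) (max (i μ) (j μ)) →
      ∀ hs : Function.update (corner i j μ) μ s ∈ (↑X : Set (Fin dd → ℤ)),
      ((SimpleGraph.fromRel (cubeAdj (id : (Fin dd → ℤ) → Fin dd → ℤ))).induce (↑X : Set (Fin dd → ℤ))).Reachable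
        ⟨corner i j μ, h0⟩ ⟨Function.update (corner i j μ) μ s, hs⟩ := by
  intro n
  induction n with
  | zero =>
      intro s hs0 _ hs
      have hsi : s = i μ := by omega
      subst hsi
      exact reachable_of_touch h0 hs (Or.inl (update_corner_self i j μ).symm)
  | succ n ih =>
      intro s hsn hsI hs
      rw [Finset.mem_Icc] at hsI
      -- the previous point of the segment, one unit closer to `i μ`
      set s' : ℤ := if i μ < s then s - 1 else s + 1 with hs'
      have hs'n : (s' - i μ).natAbs = n := by
        rw [hs']; split_ifs <;> omega
      have hs'I : s' ∈ Finset.Icc (min (i μ) (j μ)) (max (i μ) (j μ)) := by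
        rw [Finset.mem_Icc, hs']
        rcases le_total (i μ) (j μ) with hij | hij
        · rw [min_eq_left hij, max_eq_right hij] at hsI ⊢
          split_ifs <;> omega
        · rw [min_eq_right hij, max_eq_left hij] at hsI ⊢
          split_ifs <;> omega
      have hs'X : Function.update (corner i j μ) μ s' ∈ (↑X : Set (Fin dd → ℤ)) :=
        Finset.mem_coe.mpr (hX (mem_seg.mpr ⟨s', hs'I, rfl⟩))
      refine (ih s' hs'n hs'I hs'X).trans (reachable_of_touch hs'X hs (Or.inr (touch_update _ μ ?_)))
      rw [hs']; split_ifs <;> simp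

/-- every corner `corner μ` (`μ ≤ d`) is reachable from the start `i` inside any cube set containing the staircase.
[cite: BalabanImbrieJaffe1988, (5.7.5) p.289] -/
theorem reachable_corner (i j : Fin dd → ℤ) (X : Finset (Fin dd → ℤ)) (hX : stair i j ⊆ X)
    (hi : i ∈ (↑X : Set (Fin dd → ℤ))) :
    ∀ μ : ℕ, μ ≤ dd → ∀ hμ : corner i j μ ∈ (↑X : Set (Fin dd → ℤ)),
      ((SimpleGraph.fromRel (cubeAdj (id : (Fin dd → ℤ) → Fin dd → ℤ))).induce (↑X : Set (Fin dd → ℤ))).Reachable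
        ⟨i, hi⟩ ⟨corner i j μ, hμ⟩ := by
  intro μ
  induction μ with
  | zero =>
      intro _ hμ
      exact reachable_of_touch hi hμ (Or.inl (corner_zero i j).symm)
  | succ μ ih =>
      intro hμd hμ
      have hμ' : μ < dd := by omega
      have hsegX : seg i j ⟨μ, hμ'⟩ ⊆ X := fun p hp =>
        hX (Finset.mem_biUnion.mpr ⟨⟨μ, hμ'⟩, Finset.mem_univ _, hp⟩)
      have hcX : corner i j μ ∈ (↑X : Set (Fin dd → ℤ)) :=
        Finset.mem_coe.mpr (hsegX (corner_mem_seg i j ⟨μ, hμ'⟩))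
      have hjI : j ⟨μ, hμ'⟩ ∈ Finset.Icc (min (i ⟨μ, hμ'⟩) (j ⟨μ, hμ'⟩)) (max (i ⟨μ, hμ'⟩) (j ⟨μ, hμ'⟩)) := by
        simp [Finset.mem_Icc]
      have e : Function.update (corner i j μ) ⟨μ, hμ'⟩ (j ⟨μ, hμ'⟩) = corner i j (μ + 1) :=
        update_corner_next i j ⟨μ, hμ'⟩
      have hnext : Function.update (corner i j μ) ⟨μ, hμ'⟩ (j ⟨μ, hμ'⟩) ∈ (↑X : Set (Fin dd → ℤ)) := by
        rw [e]; exact hμ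
      have h := reachable_seg i j ⟨μ, hμ'⟩ X hsegX hcX _ (j ⟨μ, hμ'⟩) rfl hjI hnext
      have heq : (⟨Function.update (corner i j μ) ⟨μ, hμ'⟩ (j ⟨μ, hμ'⟩), hnext⟩ : (↑X : Set (Fin dd → ℤ)))
          = ⟨corner i j (μ + 1), hμ⟩ := Subtype.ext e
      rw [heq] at h
      exact (ih hμ'.le hcX).trans h

/-- **THE STAIRCASE IS CONNECTED THROUGH ITS START**: every cube of `stair(i,j)` is reachable from `i` inside any cube set
containing the staircase. [cite: BalabanImbrieJaffe1988, (5.7.5) p.289] -/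
theorem reachable_of_mem_stair (i j : Fin dd → ℤ) (X : Finset (Fin dd → ℤ)) (hX : stair i j ⊆ X)
    (hi : i ∈ (↑X : Set (Fin dd → ℤ))) {p : Fin dd → ℤ} (hp : p ∈ stair i j) (hpX : p ∈ (↑X : Set (Fin dd → ℤ))) :
    ((SimpleGraph.fromRel (cubeAdj (id : (Fin dd → ℤ) → Fin dd → ℤ))).induce (↑X : Set (Fin dd → ℤ))).Reachable
      ⟨i, hi⟩ ⟨p, hpX⟩ := by
  obtain ⟨μ, -, hpμ⟩ := Finset.mem_biUnion.mp hp
  obtain ⟨s, hsI, rfl⟩ := mem_seg.mp hpμ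
  have hsegX : seg i j μ ⊆ X := fun q hq => hX (Finset.mem_biUnion.mpr ⟨μ, Finset.mem_univ _, hq⟩)
  have hcX : corner i j μ ∈ (↑X : Set (Fin dd → ℤ)) := Finset.mem_coe.mpr (hsegX (corner_mem_seg i j μ))
  exact (reachable_corner i j X hX hi μ μ.isLt.le hcX).trans (reachable_seg i j μ X hsegX hcX _ s rfl hsI hpX)

/-! ## §2 The association map of (5.7.5) on `ℤ^d` -/

variable {β : Type*}

/-- **(5.7.5)**, the association on `ℤ^d`: to the bond `b` and the tuple `(b₁, …, b_m)` (bonds placed in `ℤ^d` by `pos`,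
`r(e_k)`-cubes = cube indices of side `ℓ`) associate `X = cube(b) ∪ ⋃_l stair(cube(b), cube(b_l))` — a connected union of
`r(e_k)`-cubes containing them (below). [cite: BalabanImbrieJaffe1988, (5.7.5) p.289] -/
def assocZd (pos : β → Fin dd → ℤ) (ℓ : ℕ) (b : β) (m : ℕ) (t : Fin m → β) : Finset (Fin dd → ℤ) :=
  insert (cubeIdx ℓ (pos b)) (Finset.univ.biUnion fun l => stair (cubeIdx ℓ (pos b)) (cubeIdx ℓ (pos (t l))))

/-- `X` contains the cube of `b`. [cite: BalabanImbrieJaffe1988, (5.7.5) p.289] -/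
theorem cube_mem_assocZd (pos : β → Fin dd → ℤ) (ℓ : ℕ) (b : β) (m : ℕ) (t : Fin m → β) :
    cubeIdx ℓ (pos b) ∈ assocZd pos ℓ b m t :=
  Finset.mem_insert_self _ _

/-- `X` contains the cubes of `b₁, …, b_m`. [cite: BalabanImbrieJaffe1988, (5.7.5) p.289] -/
theorem cube_tuple_mem_assocZd (pos : β → Fin dd → ℤ) (ℓ : ℕ) (b : β) (m : ℕ) (t : Fin m → β) (l : Fin m) :
    cubeIdx ℓ (pos (t l)) ∈ assocZd pos ℓ b m t := by
  unfold assocZd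
  rcases Nat.eq_zero_or_pos dd with hd | hd
  · subst hd
    rw [show cubeIdx ℓ (pos (t l)) = cubeIdx ℓ (pos b) from Subsingleton.elim _ _]
    exact Finset.mem_insert_self _ _
  · exact Finset.mem_insert_of_mem (Finset.mem_biUnion.mpr ⟨l, Finset.mem_univ _, right_mem_stair hd _ _⟩)

/-- `X` is never empty. [cite: BalabanImbrieJaffe1988, (5.7.5) p.289] -/
theorem assocZd_ne_empty (pos : β → Fin dd → ℤ) (ℓ : ℕ) (b : β) (m : ℕ) (t : Fin m → β) :
    assocZd pos ℓ b m t ≠ ∅ :=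
  Finset.ne_empty_of_mem (cube_mem_assocZd pos ℓ b m t)

/-- **`X` IS A CONNECTED UNION OF CUBES**: the touching graph (`cubeAdj id`, symmetrized) induced on `assocZd pos ℓ b m t` is
connected (the notion of `BIJ88RandomWalk242.region_connected`). [cite: BalabanImbrieJaffe1988, (5.7.5) p.289] -/
theorem assocZd_connected [Fintype β] (pos : β → Fin dd → ℤ) (ℓ : ℕ) (b : β) (m : ℕ) (t : Fin m → β) :
    ((SimpleGraph.fromRel (cubeAdj (id : (Fin dd → ℤ) → Fin dd → ℤ))).induce
      (↑(assocZd pos ℓ b m t) : Set (Fin dd → ℤ))).Connected := by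
  rw [SimpleGraph.connected_iff_exists_forall_reachable]
  have h0 : cubeIdx ℓ (pos b) ∈ (↑(assocZd pos ℓ b m t) : Set (Fin dd → ℤ)) :=
    Finset.mem_coe.mpr (cube_mem_assocZd pos ℓ b m t)
  refine ⟨⟨cubeIdx ℓ (pos b), h0⟩, fun p => ?_⟩
  obtain ⟨p, hp⟩ := p
  rcases Finset.mem_insert.mp (Finset.mem_coe.mp hp) with hpb | hp'
  · subst hpb; rfl
  · obtain ⟨l, -, hpl⟩ := Finset.mem_biUnion.mp hp'
    have hsub : stair (cubeIdx ℓ (pos b)) (cubeIdx ℓ (pos (t l))) ⊆ assocZd pos ℓ b m t := fun q hq =>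
      Finset.mem_insert_of_mem (Finset.mem_biUnion.mpr ⟨l, Finset.mem_univ _, hq⟩)
    exact reachable_of_mem_stair _ _ _ hsub h0 hpl hp

/-- card of the association: `|X| ≤ 1 + Σ_l (‖cube(b) − cube(b_l)‖₁ + d)`. [cite: BalabanImbrieJaffe1988, (5.7.5) p.289] -/
theorem card_assocZd_le [Fintype β] (pos : β → Fin dd → ℤ) (ℓ : ℕ) (b : β) (m : ℕ) (t : Fin m → β) :
    (assocZd pos ℓ b m t).card ≤ 1 + ∑ l, (l1 (cubeIdx ℓ (pos b)) (cubeIdx ℓ (pos (t l))) + dd) := by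
  unfold assocZd
  refine (Finset.card_insert_le _ _).trans ?_
  rw [add_comm]
  refine Nat.add_le_add_left (Finset.card_biUnion_le.trans (Finset.sum_le_sum fun l _ => card_stair_le _ _)) 1

/-! ### Tightness: cube-index steps are controlled by lattice distances -/

/-- **CUBE ARITHMETIC**: `ℓ·|x/ℓ − y/ℓ| ≤ |x − y| + (ℓ − 1)` for integers `x, y` and the side `ℓ ≥ 1` (Euclidean division).
[cite: BalabanImbrieJaffe1988, (5.7.5) p.289] -/
theorem mul_abs_div_sub_div_le {ℓ : ℕ} (hℓ : 0 < ℓ) (x y : ℤ) :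
    (ℓ : ℤ) * |x / (ℓ : ℤ) - y / (ℓ : ℤ)| ≤ |x - y| + ((ℓ : ℤ) - 1) := by
  have hℓ' : (0 : ℤ) < ℓ := by exact_mod_cast hℓ
  have hx : x % (ℓ : ℤ) = x - (ℓ : ℤ) * (x / (ℓ : ℤ)) := Int.emod_def x ℓ
  have hy : y % (ℓ : ℤ) = y - (ℓ : ℤ) * (y / (ℓ : ℤ)) := Int.emod_def y ℓ
  have hx0 : 0 ≤ x % (ℓ : ℤ) := Int.emod_nonneg x hℓ'.ne'
  have hx1 : x % (ℓ : ℤ) < ℓ := Int.emod_lt_of_pos x hℓ'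
  have hy0 : 0 ≤ y % (ℓ : ℤ) := Int.emod_nonneg y hℓ'.ne'
  have hy1 : y % (ℓ : ℤ) < ℓ := Int.emod_lt_of_pos y hℓ'
  have e1 : (ℓ : ℤ) * |x / (ℓ : ℤ) - y / (ℓ : ℤ)| = |(ℓ : ℤ) * (x / (ℓ : ℤ) - y / (ℓ : ℤ))| := by
    rw [abs_mul, abs_of_pos hℓ']
  have e2 : (ℓ : ℤ) * (x / (ℓ : ℤ) - y / (ℓ : ℤ)) = (x - y) - (x % (ℓ : ℤ) - y % (ℓ : ℤ)) := by
    rw [hx, hy]; ring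
  rw [e1, e2]
  have h3 : |x % (ℓ : ℤ) - y % (ℓ : ℤ)| ≤ (ℓ : ℤ) - 1 := by
    rw [abs_le]; constructor <;> omega
  linarith [abs_sub (x - y) (x % (ℓ : ℤ) - y % (ℓ : ℤ))]

/-- **STEPS VERSUS DISTANCE**: `ℓ·‖cube(x) − cube(y)‖₁ ≤ d·(supDist x y + ℓ)` — a staircase between the cubes of two lattice
points has at most `d(dist/ℓ + 1)` steps. [cite: BalabanImbrieJaffe1988, (5.7.5) p.289] -/
theorem mul_l1_cubeIdx_le {ℓ : ℕ} (hℓ : 0 < ℓ) (x y : Fin dd → ℤ) :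
    (ℓ : ℝ) * l1 (cubeIdx ℓ x) (cubeIdx ℓ y) ≤ dd * (supDist x y + ℓ) := by
  unfold l1
  rw [Nat.cast_sum, Finset.mul_sum]
  calc ∑ μ, (ℓ : ℝ) * (((cubeIdx ℓ x μ - cubeIdx ℓ y μ).natAbs : ℕ) : ℝ)
      ≤ ∑ _μ : Fin dd, (supDist x y + ℓ) := by
        refine Finset.sum_le_sum fun μ _ => ?_
        have hz := mul_abs_div_sub_div_le hℓ (x μ) (y μ)
        have hnat : ℓ * (x μ / (ℓ : ℤ) - y μ / (ℓ : ℤ)).natAbs ≤ (x μ - y μ).natAbs + ℓ := by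
          have hz' : ((ℓ * (x μ / (ℓ : ℤ) - y μ / (ℓ : ℤ)).natAbs : ℕ) : ℤ) ≤ (((x μ - y μ).natAbs + ℓ : ℕ) : ℤ) := by
            rw [Nat.cast_mul, Nat.cast_add, Int.natCast_natAbs, Int.natCast_natAbs]
            linarith
          exact_mod_cast hz'
        have h1 : (ℓ : ℝ) * ((((x μ / (ℓ : ℤ) - y μ / (ℓ : ℤ)).natAbs : ℕ) : ℝ))
            ≤ (((x μ - y μ).natAbs : ℕ) : ℝ) + ℓ := by
          exact_mod_cast hnat
        have h2 : (((x μ - y μ).natAbs : ℕ) : ℝ) ≤ supDist x y := natAbs_le_supDist x y μ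
        show (ℓ : ℝ) * ((((x μ / (ℓ : ℤ) - y μ / (ℓ : ℤ)).natAbs : ℕ) : ℝ)) ≤ supDist x y + ℓ
        linarith
    _ = dd * (supDist x y + ℓ) := by rw [Finset.sum_const, Finset.card_univ, Fintype.card_fin, nsmul_eq_mul]

/-- **TIGHTNESS OF THE ASSOCIATION**: `ℓ(|X| − 1) ≤ d·Σ_l supDist(b, b_l) + 2d·m·ℓ` for `X = assocZd pos ℓ b m (b₁,…,b_m)`.
[cite: BalabanImbrieJaffe1988, (5.7.6) p.290] -/
theorem tight_assocZd [Fintype β] (pos : β → Fin dd → ℤ) {ℓ : ℕ} (hℓ : 0 < ℓ) (b : β) (m : ℕ) (t : Fin m → β) :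
    (ℓ : ℝ) * (((assocZd pos ℓ b m t).card : ℝ) - 1) ≤
      dd * ∑ l, supDist (pos b) (pos (t l)) + 2 * dd * m * ℓ := by
  have hcard : (((assocZd pos ℓ b m t).card : ℕ) : ℝ) ≤
      1 + ∑ l, (((l1 (cubeIdx ℓ (pos b)) (cubeIdx ℓ (pos (t l))) : ℕ) : ℝ) + dd) := by
    exact_mod_cast card_assocZd_le pos ℓ b m t
  have hsum : (ℓ : ℝ) * ∑ l, (((l1 (cubeIdx ℓ (pos b)) (cubeIdx ℓ (pos (t l))) : ℕ) : ℝ) + dd)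
      ≤ dd * ∑ l, supDist (pos b) (pos (t l)) + 2 * dd * m * ℓ := by
    rw [Finset.mul_sum]
    calc ∑ l, (ℓ : ℝ) * ((((l1 (cubeIdx ℓ (pos b)) (cubeIdx ℓ (pos (t l))) : ℕ) : ℝ)) + dd)
        ≤ ∑ l, (dd * supDist (pos b) (pos (t l)) + 2 * dd * ℓ) := by
          refine Finset.sum_le_sum fun l _ => ?_
          have := mul_l1_cubeIdx_le hℓ (pos b) (pos (t l))
          nlinarith
      _ = dd * ∑ l, supDist (pos b) (pos (t l)) + 2 * dd * m * ℓ := by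
          rw [Finset.sum_add_distrib, Finset.mul_sum, Finset.sum_const, Finset.card_univ, Fintype.card_fin, nsmul_eq_mul]
          ring
  have hℓ0 : (0 : ℝ) ≤ ℓ := Nat.cast_nonneg ℓ
  nlinarith

end

end Literature.MathematicalPhysics.QuantumFieldTheory.BalabanImbrieJaffe1984to88.BIJ88Assoc575Zd
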